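import Mathlib
import Summits.ValiantsHypothesis.ValiantsHypothesis.Theses.FreeSubtorus
import Summits.ValiantsHypothesis.ValiantsHypothesis.Theorems.FreeSubtorusSubtorusCovering
import Summits.ValiantsHypothesis.ValiantsHypothesis.Cruxes.OrbitDimensionBound.Lines.ConfusionLadder
import Literature.Computability.AlgebraicComplexity.GrenetEquivariant
import Literature.Computability.AlgebraicComplexity.EquivariantDC
import Literature.Computability.AlgebraicComplexity.DetReprEquivalent
import Literature.Computability.AlgebraicComplexity.PBoundedGrowth

/-!
# `GaugeLadder` — the GAUGE-DEGREE family through the PROVED floor `SubtorusCovering`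
# (crux dir of stmt-ValiantsHypothesis-16133 `OrbitDimensionBound`, route FreeSubtorus; forward rung G1 gen 6, sorry-free)

FLOOR (seed g1-ValiantsHypothesis-16134, landed):
`Summit.ValiantsHypothesis.ValiantsHypothesis.Theorems.FreeSubtorusSubtorusCovering.subtorusCovering_proof :
 Theses.FreeSubtorus.SubtorusCovering` — for `n ≥ 3`, an affine determinantal representation `B` of `per_n` of size `m`
that is `T_Λ`-equivariant with EXACT CONSTANT lifts `(g, h) ∈ GL_m(ℂ) × GL_m(ℂ)` (`B(γ·x) = g · B(x) · h⁻¹`,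
Landsberg–Ressayre's Definition 1.3: "Gaussian elimination with constants"), `Λ` admissible with `r` generators, has
`C(n, ⌊n/2⌋) ≤ m · 2^r`.

THE ONE MOVE (a hypothesis generalised, in the direction of the symmetry-free Statement): the LIFT GROUP.  The floor
asks the class of `B` in the quotient by the CONSTANT gauge group `GL_m(ℂ) × GL_m(ℂ)` to be fixed by `T_Λ`; the rung asks
it only in the quotient by the POLYNOMIAL (unimodular) gauge group `GL_m(ℂ[x]) × GL_m(ℂ[x])` — the gauge quotient of the
hub's typing checklist 4c(i) — graded by the DEGREE `q` of the gauge matrices: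
`GaugeLifts q S B := ∀ γ ∈ S, ∃ g h ∈ M_m(ℂ[x])` with entries of total degree `≤ q`, `det g, det h ∈ ℂ[x]ˣ = ℂˣ`, and
`B(γ·x) · h = g · B(x)`.  `q = 0` is LITERALLY the floor's lift condition (`gaugeLifts_zero_iff`: a degree-`0`
polynomial matrix with unit determinant is `GL_m(ℂ)` embedded by `C`), so

* `GaugeCovering 0 ↔ SubtorusCovering` (`gaugeCovering_zero_iff`, both directions through
  `IsEquivariantDetRepr.of_generators`), `gaugeCovering_zero` = the seed;
* the family is ANTITONE in `q` (`GaugeCovering.anti`: more gauge allowed = weaker hypothesis = stronger rung), every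
  member implies the floor (`subtorusCovering_of_gaugeCovering`);
* THE RUNG is the first open member `AffineGaugeCovering := GaugeCovering 1` (affine unimodular gauge): its hypothesis
  class is STRICTLY larger than the floor's already at `(n, m) = (3, 7)` — the Koszul-twisted Grenet matrix
  `(1+V)·G₇·(1-U)` of the crux's `Disproof.lean` §4 (the witness that refuted `UlrichPadded.NoTightInfinity`,
  negatives index stmt-5668) admits NO constant lift of the homothety `x ↦ 2x` (`twistedGrenet_no_homothety_lift`, landed)
  but admits the AFFINE unimodular lifts `g = D + 2VD - DV`, `h = D' + 2UD' - D'U` (`D, D'` Grenet's diagonal level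
  scalings) — see the companion file `Lines/affine_gauge_witness.lean`;
* where the Statement sits: as `q → ∞` the symmetry hypothesis EVAPORATES on layered branching programs — a layered
  algebraic branching program matrix `B = [[0, u],[v, 1 - N]]` (`N` strictly block-triangular) is unimodularly
  equivalent to `diag(per_n, 1, …, 1)` by a Schur-complement gauge of degree `≤ depth`, and so is `B(t·x)` for every
  torus element `t`; hence `GaugeCovering q` for `q ≥ n - 1` contains the exponential LAYERED-ABP lower bound
  `C(n,⌊n/2⌋) ≤ size` for `per_n` (open; the known ABP/dc lower bounds are quadratic, Mignon–Ressayre / Kumar), and the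
  top of the dial is the symmetry-free waypoint `per ∉ VBP` below `VP ≠ VNP`.  The dial `q` therefore interpolates
  between torus-EQUIVARIANT lower bounds (`q = 0`, a theorem) and GENERAL branching-program lower bounds (`q ≥ n - 1`).

ASYMPTOTIC SHADOW / ON-PATH.  `GaugeShadow q`: along any sequence of admissibly cut subtori and affine representations
`B_n` of `per_n` of sizes `m_n` with degree-`q` gauge lifts, `n ↦ m_n · 2^{r_n}` is not p-bounded.
`gaugeShadow_of_summit : ValiantsHypothesis → GaugeShadow q` for EVERY `q` (only `dc(per_n) ≤ m_n` is used: p-bounded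
`dc` ⇒ `per ∈ VP` ⇒ `VP = VNP`, tree), `gaugeShadow_zero_iff : GaugeShadow 0 ↔ CoveringShadow powLoss` (the floor's
shadow, gen 1), and the filed rung declaration is `AffineGaugeShadow := GaugeShadow 1`.

HOW THE RUNG ADVANCES THE OPEN CRUX `OrbitDimensionBound` (stmt-16133).  The symmetrisation target relaxes to
`OrbitGaugeBound q`: re-realise an optimal expression at the same size with an admissible `T_Λ`, `r ≤ n/2`, that fixes
its class only MODULO DEGREE-`q` GAUGE.  `closes_gauge : OrbitGaugeBound q → GaugeCovering q → ValiantsHypothesis`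
(via gen 1's `vh_of_middle_bound`), `orbitGaugeBound_of_orbitDimensionBound : OrbitDimensionBound → OrbitGaugeBound q`.
The relaxation removes exactly the obstruction recorded in `Disproof.lean` §4 (exit E1 of `STRATEGY-CENSUS.md`):
"symmetry cannot be imposed in place" is a CONSTANT-gauge phenomenon — its witness, the twisted Grenet matrix, IS
affine-gauge symmetric in place.

The `r = 0` ENGINE family `GaugeTorusBound q` (full two-sided torus, degree-`q` lifts ⇒ `2^n - 1 ≤ m`) specialises at
`q = 0` to the landed `Theorems.BorderApolarityToricWitnessObstructionQP.stub_torusBound` (`gaugeTorusBound_zero`); the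
line's skeleton (`Lines/affine_gauge.lean`) reduces `AffineGaugeCovering` to `GaugeTorusBound 1` by the floor's own
pair-sacrifice substitution (degree-`1` lifts survive substitution) and `GaugeTorusBound 1` to an UNTWISTING statement
(torus cohomology with values in the unipotent group of affine Koszul twists vanishes: a degree-`1`-gauge-symmetric
representation is unimodularly equivalent, at the same size, to one with constant lifts).
[cite: LandsbergRessayre2017, Def. 1.3, Thm. 2.8, Question 2.2] [cite: MignonRessayre2004, §1] [cite: Grenet2011, Thm. 1]
-/

set_option linter.dupNamespace false

namespace Summit.ValiantsHypothesis.ValiantsHypothesis.Cruxes.OrbitDimensionBound.Gauge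

open Matrix MvPolynomial
open Literature.Computability.AlgebraicComplexity
open Summit.ValiantsHypothesis.ValiantsHypothesis.Cruxes.OrbitDimensionBound.Confusion

noncomputable section

/-! ## §1 Degree-`q` unimodular gauge lifts; the torus generator sets -/

/-- **`GaugeLifts q S B`**: every substitution `γ ∈ S` lifts to a pair of POLYNOMIAL matrices `g, h ∈ M_m(ℂ[x])` with
entries of total degree `≤ q` and unit determinants (`det ∈ ℂ[x]ˣ = ℂˣ`, i.e. `g, h ∈ GL_m(ℂ[x])`) such that
`B(γ·x) · h = g · B(x)`.  At `q = 0` this is Landsberg–Ressayre's exact-lift condition (`gaugeLifts_zero_iff`).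
[cite: LandsbergRessayre2017, Def. 1.3] -/
def GaugeLifts (q : ℕ) {n m : ℕ} (S : Set (GL (Fin n × Fin n) ℂ))
    (B : Matrix (Fin m) (Fin m) (MvPolynomial (Fin n × Fin n) ℂ)) : Prop :=
  ∀ γ ∈ S, ∃ g h : Matrix (Fin m) (Fin m) (MvPolynomial (Fin n × Fin n) ℂ),
    (∀ i j, (g i j).totalDegree ≤ q) ∧ (∀ i j, (h i j).totalDegree ≤ q) ∧
    IsUnit g.det ∧ IsUnit h.det ∧
    Matrix.linSubstEntries γ B * h = g * B

/-- The generator set of the subtorus `T_Λ` cut out by the characters `Λ_i` — VERBATIM the floor's. [folklore] -/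
def subtorusGen (n r : ℕ) (Λ : Fin r → (Fin n ⊕ Fin n) → ℤ) : Set (GL (Fin n × Fin n) ℂ) :=
  {γ : Matrix.GeneralLinearGroup (Fin n × Fin n) ℂ |
    ∃ d e : Fin n → ℂˣ, (∀ i, (∏ k, (d k) ^ (Λ i (Sum.inl k))) * (∏ l, (e l) ^ (Λ i (Sum.inr l))) = 1) ∧
      (γ : Matrix (Fin n × Fin n) (Fin n × Fin n) ℂ) = Matrix.diagonal (fun p => (d p.1 : ℂ) * (e p.2 : ℂ))}

/-- The generator set of the FULL two-sided torus `x ↦ D₁ x D₂` — VERBATIM `RigidityForcesSymmetry.TorusBound`'s.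
[folklore] -/
def fullTorusGen (n : ℕ) : Set (GL (Fin n × Fin n) ℂ) :=
  {γ : GL (Fin n × Fin n) ℂ | ∃ d e : Fin n → ℂ,
    (γ : Matrix (Fin n × Fin n) (Fin n × Fin n) ℂ) = Matrix.diagonal (fun p => d p.1 * e p.2)}

/-- Dial monotonicity of the lift condition: degree-`q` lifts are degree-`q'` lifts for `q ≤ q'`. [folklore] -/
theorem GaugeLifts.mono {q q' : ℕ} (hq : q ≤ q') {n m : ℕ} {S : Set (GL (Fin n × Fin n) ℂ)}
    {B : Matrix (Fin m) (Fin m) (MvPolynomial (Fin n × Fin n) ℂ)} (h : GaugeLifts q S B) : GaugeLifts q' S B := by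
  intro γ hγ
  obtain ⟨g, k, hg, hk, hgu, hku, heq⟩ := h γ hγ
  exact ⟨g, k, fun i j => (hg i j).trans hq, fun i j => (hk i j).trans hq, hgu, hku, heq⟩

/-- Restricting the set of substitutions. [folklore] -/
theorem GaugeLifts.subset {q : ℕ} {n m : ℕ} {S S' : Set (GL (Fin n × Fin n) ℂ)} (hS : S' ⊆ S)
    {B : Matrix (Fin m) (Fin m) (MvPolynomial (Fin n × Fin n) ℂ)} (h : GaugeLifts q S B) : GaugeLifts q S' B :=
  fun γ hγ => h γ (hS hγ)

section Conversion

variable {n m : ℕ}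

/-- A polynomial matrix with all entries of total degree `0` is the `C`-image of a constant matrix. [folklore] -/
theorem eq_map_C_of_totalDegree_le_zero (g : Matrix (Fin m) (Fin m) (MvPolynomial (Fin n × Fin n) ℂ))
    (hg : ∀ i j, (g i j).totalDegree ≤ 0) :
    ∃ G : Matrix (Fin m) (Fin m) ℂ, g = G.map C :=
  ⟨g.map (fun p => p.coeff 0), Matrix.ext fun i j => by
    simp only [Matrix.map_apply]
    exact totalDegree_eq_zero_iff_eq_C.mp (Nat.le_zero.mp (hg i j))⟩

/-- A constant matrix whose `C`-image has unit determinant in `M_m(ℂ[x])` is invertible. [folklore] -/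
theorem isUnit_of_isUnit_det_map_C (G : Matrix (Fin m) (Fin m) ℂ)
    (hu : IsUnit (G.map (C : ℂ →+* MvPolynomial (Fin n × Fin n) ℂ)).det) : IsUnit G := by
  rw [Matrix.isUnit_iff_isUnit_det]
  have h1 : IsUnit (MvPolynomial.constantCoeff ((G.map (C : ℂ →+* MvPolynomial (Fin n × Fin n) ℂ)).det)) :=
    hu.map _
  rwa [← RingHom.mapMatrix_apply, ← RingHom.map_det, MvPolynomial.constantCoeff_C] at h1

/-- **`q = 0` is the floor's lift condition**: degree-`0` unimodular polynomial lifts are exactly constant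
`GL_m(ℂ) × GL_m(ℂ)` lifts in Landsberg–Ressayre's form `B(γ·x) = g · B · h⁻¹`. [cite: LandsbergRessayre2017, Def. 1.3] -/
theorem gaugeLifts_zero_iff (S : Set (GL (Fin n × Fin n) ℂ))
    (B : Matrix (Fin m) (Fin m) (MvPolynomial (Fin n × Fin n) ℂ)) :
    GaugeLifts 0 S B ↔
      ∀ γ ∈ S, ∃ g h : GL (Fin m) ℂ,
        Matrix.linSubstEntries γ B =
          (g : Matrix (Fin m) (Fin m) ℂ).map C * B * ((h⁻¹ : GL (Fin m) ℂ) : Matrix (Fin m) (Fin m) ℂ).map C := by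
  constructor
  · intro hL γ hγ
    obtain ⟨g, k, hg, hk, hgu, hku, heq⟩ := hL γ hγ
    obtain ⟨G, rfl⟩ := eq_map_C_of_totalDegree_le_zero g hg
    obtain ⟨K, rfl⟩ := eq_map_C_of_totalDegree_le_zero k hk
    have hGu := isUnit_of_isUnit_det_map_C G hgu
    have hKu := isUnit_of_isUnit_det_map_C K hku
    refine ⟨hGu.unit, hKu.unit, ?_⟩
    have hKinv : K.map C * (((hKu.unit⁻¹ : GL (Fin m) ℂ) : Matrix (Fin m) (Fin m) ℂ).map C) =
        (1 : Matrix (Fin m) (Fin m) (MvPolynomial (Fin n × Fin n) ℂ)) := by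
      rw [← Matrix.map_mul]
      have e1 : K * ((hKu.unit⁻¹ : GL (Fin m) ℂ) : Matrix (Fin m) (Fin m) ℂ) = 1 := by
        have := Units.mul_inv hKu.unit
        rwa [IsUnit.unit_spec] at this
      rw [e1, Matrix.map_one C C_0 C_1]
    calc Matrix.linSubstEntries γ B
        = Matrix.linSubstEntries γ B *
            (K.map C * (((hKu.unit⁻¹ : GL (Fin m) ℂ) : Matrix (Fin m) (Fin m) ℂ).map C)) := by
          rw [hKinv, Matrix.mul_one]
      _ = (Matrix.linSubstEntries γ B * K.map C) *
            (((hKu.unit⁻¹ : GL (Fin m) ℂ) : Matrix (Fin m) (Fin m) ℂ).map C) := by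
          rw [Matrix.mul_assoc]
      _ = G.map C * B * (((hKu.unit⁻¹ : GL (Fin m) ℂ) : Matrix (Fin m) (Fin m) ℂ).map C) := by rw [heq]
      _ = ((hGu.unit : GL (Fin m) ℂ) : Matrix (Fin m) (Fin m) ℂ).map C * B *
            (((hKu.unit⁻¹ : GL (Fin m) ℂ) : Matrix (Fin m) (Fin m) ℂ).map C) := by
          rw [IsUnit.unit_spec]
  · intro hL γ hγ
    obtain ⟨g, k, heq⟩ := hL γ hγ
    refine ⟨(g : Matrix (Fin m) (Fin m) ℂ).map C, (k : Matrix (Fin m) (Fin m) ℂ).map C, ?_, ?_, ?_, ?_, ?_⟩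
    · intro i j; simp [totalDegree_C]
    · intro i j; simp [totalDegree_C]
    · rw [← RingHom.mapMatrix_apply, ← RingHom.map_det]
      exact (Matrix.isUnits_det_units g).map _
    · rw [← RingHom.mapMatrix_apply, ← RingHom.map_det]
      exact (Matrix.isUnits_det_units k).map _
    · rw [heq, Matrix.mul_assoc ((g : Matrix (Fin m) (Fin m) ℂ).map C * B), ← Matrix.map_mul, ← Units.val_mul,
        inv_mul_cancel, Units.val_one, Matrix.map_one C C_0 C_1, Matrix.mul_one]

end Conversion

/-! ## §2 The graded covering family, the floor (`q = 0`), the rung (`q = 1`) -/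

/-- **The graded family `GaugeCovering q`** (gauge degree `q`).  For `n ≥ 3`: every affine determinantal representation
`B` of `per_n` of size `m` whose class modulo DEGREE-`q` UNIMODULAR GAUGE is fixed by an admissibly cut subtorus `T_Λ`
(`r` generators; degree-`q` lifts of every generator) satisfies `C(n, ⌊n/2⌋) ≤ m · 2^r`.  The body is the floor
`Theses.FreeSubtorus.SubtorusCovering` with `IsEquivariantDetRepr` (constant lifts) replaced by
`IsAffineDetRepr ∧ GaugeLifts q`. [cite: LandsbergRessayre2017, Thm. 2.8, Question 2.2] -/
def GaugeCovering (q : ℕ) : Prop :=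
  ∀ n : ℕ, 3 ≤ n → ∀ (m r : ℕ) (Λ : Fin r → (Fin n ⊕ Fin n) → ℤ)
    (B : Matrix (Fin m) (Fin m) (MvPolynomial (Fin n × Fin n) ℂ)),
    (∀ i, (∑ k, Λ i (Sum.inl k)) = 0 ∧ (∑ l, Λ i (Sum.inr l)) = 0) →
    IsAffineDetRepr (perPoly (Fin n) ℂ) B →
    GaugeLifts q (subtorusGen n r Λ) B →
    Nat.choose n (n / 2) ≤ m * 2 ^ r

/-- **THE RUNG `AffineGaugeCovering`** (one move up from the floor: constant gauge `GL_m(ℂ)²` ↦ AFFINE unimodular gauge,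
degree `≤ 1`).  For `n ≥ 3`, an affine determinantal representation of `per_n` of size `m` with affine unimodular
`T_Λ`-lifts (`Λ` admissible, `r` generators) has `C(n, ⌊n/2⌋) ≤ m · 2^r`. [cite: LandsbergRessayre2017, Question 2.2] -/
def AffineGaugeCovering : Prop := GaugeCovering 1

/-- Dial monotonicity (harder-to-easier): a smaller gauge degree is a weaker rung. [folklore] -/
theorem GaugeCovering.anti {q q' : ℕ} (hq : q ≤ q') (h : GaugeCovering q') : GaugeCovering q :=
  fun n hn m r Λ B hΛ hB hL => h n hn m r Λ B hΛ hB (hL.mono hq)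

/-- **`q = 0` IS the floor** (both directions: `Subgroup.subset_closure` one way, exact lifts compose —
`IsEquivariantDetRepr.of_generators` — the other). [cite: LandsbergRessayre2017, Def. 1.3, Thm. 2.8] -/
theorem gaugeCovering_zero_iff :
    GaugeCovering 0 ↔ Summit.ValiantsHypothesis.ValiantsHypothesis.Theses.FreeSubtorus.SubtorusCovering := by
  constructor
  · intro hG n hn m r Λ B hΛ hB
    exact hG n hn m r Λ B hΛ hB.1
      ((gaugeLifts_zero_iff _ _).mpr fun γ hγ => hB.2 γ (Subgroup.subset_closure hγ))
  · intro hS n hn m r Λ B hΛ hA hL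
    exact hS n hn m r Λ B hΛ (IsEquivariantDetRepr.of_generators hA ((gaugeLifts_zero_iff _ _).mp hL))

/-- **The floor is proved** (seed g1-ValiantsHypothesis-16134, `subtorusCovering_proof`): `GaugeCovering 0`.
[cite: LandsbergRessayre2017, Thm. 2.8] -/
theorem gaugeCovering_zero : GaugeCovering 0 :=
  gaugeCovering_zero_iff.mpr
    Summit.ValiantsHypothesis.ValiantsHypothesis.Theorems.FreeSubtorusSubtorusCovering.subtorusCovering_proof

/-- Every member of the family implies the floor. [cite: LandsbergRessayre2017, Thm. 2.8] -/
theorem subtorusCovering_of_gaugeCovering {q : ℕ} (h : GaugeCovering q) :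
    Summit.ValiantsHypothesis.ValiantsHypothesis.Theses.FreeSubtorus.SubtorusCovering :=
  gaugeCovering_zero_iff.mp (h.anti (Nat.zero_le q))

/-- In gen-1's loss language: every member implies `CoveringRung powLoss`. [folklore] -/
theorem coveringRung_powLoss_of_gaugeCovering {q : ℕ} (h : GaugeCovering q) : CoveringRung powLoss :=
  subtorusCovering_of_gaugeCovering h

/-! ## §3 The asymptotic shadow and the on-path lemma `S → shadow` -/

/-- **Asymptotic shadow of `GaugeCovering q`.**  Along ANY sequence `(Λ_n, B_n)` of admissible lattice data and affine
determinantal representations `B_n` of `per_n` of sizes `m_n` (`n ≥ 3`) with degree-`q` unimodular lifts of the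
generators of `T_{Λ_n}`, the function `n ↦ m_n · 2^{r_n}` is not p-bounded. [cite: LandsbergRessayre2017, Question 2.2] -/
def GaugeShadow (q : ℕ) : Prop :=
  ∀ (m r : ℕ → ℕ) (Λ : (n : ℕ) → Fin (r n) → (Fin n ⊕ Fin n) → ℤ)
    (B : (n : ℕ) → Matrix (Fin (m n)) (Fin (m n)) (MvPolynomial (Fin n × Fin n) ℂ)),
    (∀ n : ℕ, 3 ≤ n →
      (∀ i, (∑ k, Λ n i (Sum.inl k)) = 0 ∧ (∑ l, Λ n i (Sum.inr l)) = 0) ∧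
      IsAffineDetRepr (perPoly (Fin n) ℂ) (B n) ∧
      GaugeLifts q (subtorusGen n (r n) (Λ n)) (B n)) →
    ¬ IsPBounded (fun n => m n * 2 ^ r n)

/-- **THE FILED RUNG DECLARATION `AffineGaugeShadow`** — the asymptotic, fixed-`n`-free form of `AffineGaugeCovering`
(the summit is asymptotic and symmetry-free, so this is the form it implies). [cite: LandsbergRessayre2017, Question 2.2] -/
def AffineGaugeShadow : Prop := GaugeShadow 1

/-- Dial monotonicity of the shadow. [folklore] -/
theorem GaugeShadow.anti {q q' : ℕ} (hq : q ≤ q') (h : GaugeShadow q') : GaugeShadow q :=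
  fun m r Λ B hyp => h m r Λ B fun n hn => ⟨(hyp n hn).1, (hyp n hn).2.1, (hyp n hn).2.2.mono hq⟩

/-- A numeric member implies its shadow (`C(n,⌊n/2⌋)` is not p-bounded, tree `not_isPBounded_choose_middle`).
[folklore] -/
theorem gaugeShadow_of_gaugeCovering {q : ℕ} (h : GaugeCovering q) : GaugeShadow q := by
  intro m r Λ B hyp hPB
  exact not_isPBounded_choose_middle (IsPBounded.of_eventually_le 3 hPB fun n hn =>
    h n hn (m n) (r n) (Λ n) (B n) (hyp n hn).1 (hyp n hn).2.1 (hyp n hn).2.2)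

/-- Rung (numeric) ⇒ rung (shadow). [folklore] -/
theorem affineGaugeShadow_of_affineGaugeCovering (h : AffineGaugeCovering) : AffineGaugeShadow :=
  gaugeShadow_of_gaugeCovering h

/-- **`q = 0` of the shadow IS the floor's shadow** (gen 1's `CoveringShadow powLoss`). [cite: LandsbergRessayre2017, Thm. 2.8] -/
theorem gaugeShadow_zero_iff : GaugeShadow 0 ↔ CoveringShadow powLoss := by
  constructor
  · intro hG m r Λ B hyp hPB
    refine hG m r Λ B (fun n hn => ⟨(hyp n hn).1, (hyp n hn).2.1, ?_⟩) hPB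
    exact (gaugeLifts_zero_iff _ _).mpr fun γ hγ => (hyp n hn).2.2 γ (Subgroup.subset_closure hγ)
  · intro hS m r Λ B hyp hPB
    refine hS m r Λ B (fun n hn => ⟨(hyp n hn).1, ?_⟩) hPB
    exact IsEquivariantDetRepr.of_generators (hyp n hn).2.1 ((gaugeLifts_zero_iff _ _).mp (hyp n hn).2.2)

/-- The floor's parameter value of the shadow is a theorem (seed + `not_isPBounded_choose_middle`). [folklore] -/
theorem gaugeShadow_zero : GaugeShadow 0 :=
  gaugeShadow_of_gaugeCovering gaugeCovering_zero

/-- **ON-PATH LEMMA `S → shadow`** for EVERY gauge degree: `VP_ℂ ≠ VNP_ℂ` implies `GaugeShadow q`.  Only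
`dc(per_n) ≤ m_n` is used: a p-bounded `dc(per)` makes `per` a `VP` family
(`isVPFamily_of_isPBounded_determinantalComplexity`), hence `PER ∈ VP`, hence `VP = VNP`
(`perFamily_mem_VP_iff_VP_eq_VNP`, char `ℂ ≠ 2`). [cite: Burgisser2000, Thm. 2.10, §2.5] [cite: Valiant1979] -/
theorem gaugeShadow_of_summit (q : ℕ) (hS : _root_.ValiantsHypothesis) : GaugeShadow q := by
  intro m r Λ B hyp hPB
  have hdc : IsPBounded (fun n => determinantalComplexity (perPoly (Fin n) ℂ)) := by
    refine IsPBounded.of_eventually_le 3 hPB fun n hn => ?_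
    have hrep : HasDetRepr (perPoly (Fin n) ℂ) (m n) := ⟨B n, (hyp n hn).2.1⟩
    calc determinantalComplexity (perPoly (Fin n) ℂ) ≤ m n := determinantalComplexity_le_of_hasDetRepr hrep
      _ = m n * 1 := (mul_one _).symm
      _ ≤ m n * 2 ^ r n := Nat.mul_le_mul_left _ Nat.one_le_two_pow
  have hι : IsPBounded (fun n => Fintype.card (Fin n × Fin n)) :=
    (IsPBounded.mul_holds IsPBounded.id IsPBounded.id).mono fun n => by simp
  have hVP : IsVPFamily (fun n => perPoly (Fin n) ℂ) :=
    Summit.ValiantsHypothesis.Theorems.DeterminantalRigidityReductions.isVPFamily_of_isPBounded_determinantalComplexity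
      hι hdc
  have hmem : perFamily ℂ ∈ VP ℂ := (mem_VP_ofFintype_iff_holds (fun n => perPoly (Fin n) ℂ)).2 hVP
  have hEq : VP ℂ = VNP ℂ := (perFamily_mem_VP_iff_VP_eq_VNP ℂ ringChar_complex_ne_two).1 hmem
  exact hS hEq

/-- **`S → Rung`**: `ValiantsHypothesis → AffineGaugeShadow` (tagged for `aesop`). [cite: LandsbergRessayre2017, Question 2.2] -/
@[aesop safe apply]
theorem affineGaugeShadow_of_summit (hS : _root_.ValiantsHypothesis) : AffineGaugeShadow :=
  gaugeShadow_of_summit 1 hS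

/-- Rung (shadow) ⇒ floor's shadow. [folklore] -/
theorem powShadow_of_affineGaugeShadow (h : AffineGaugeShadow) : CoveringShadow powLoss :=
  gaugeShadow_zero_iff.mp (h.anti (Nat.zero_le 1))

/-! ## §4 The `r = 0` engine family (full two-sided torus) -/

/-- **`GaugeTorusBound q`** — the `r = 0` engine at gauge degree `q`: for `n ≥ 3`, an affine determinantal representation
of `per_n` admitting degree-`q` unimodular lifts of EVERY two-sided torus substitution `x ↦ D₁ x D₂` has size
`≥ 2^n - 1` (Grenet is optimal among them).  At `q = 0` this is the landed `RigidityForcesSymmetry.TorusBound`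
(`gaugeTorusBound_zero`). [cite: LandsbergRessayre2017, Thm. 2.8] [cite: Grenet2011, Thm. 1] -/
def GaugeTorusBound (q : ℕ) : Prop :=
  ∀ n : ℕ, 3 ≤ n → ∀ (m : ℕ) (B : Matrix (Fin m) (Fin m) (MvPolynomial (Fin n × Fin n) ℂ)),
    IsAffineDetRepr (perPoly (Fin n) ℂ) B → GaugeLifts q (fullTorusGen n) B → 2 ^ n - 1 ≤ m

/-- Dial monotonicity of the engine. [folklore] -/
theorem GaugeTorusBound.anti {q q' : ℕ} (hq : q ≤ q') (h : GaugeTorusBound q') : GaugeTorusBound q :=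
  fun n hn m B hB hL => h n hn m B hB (hL.mono hq)

/-- **The engine at `q = 0` is landed**: `Theorems.BorderApolarityToricWitnessObstructionQP.stub_torusBound`
(regularity — von zur Gathen 1987 — plus one generic torus element and eigenspace descent). [cite: LandsbergRessayre2017, Thm. 2.8] -/
theorem gaugeTorusBound_zero : GaugeTorusBound 0 := fun n hn m B hB hL =>
  Summit.ValiantsHypothesis.ValiantsHypothesis.Theorems.BorderApolarityToricWitnessObstructionQP.stub_torusBound
    n hn m B (IsEquivariantDetRepr.of_generators hB ((gaugeLifts_zero_iff _ _).mp hL))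

/-! ## §5 How the rung relaxes the open crux `OrbitDimensionBound` -/

/-- **`OrbitGaugeBound q`** — the symmetrisation target RELAXED by the rung: for `n ≥ 3`, every affine determinantal
representation `A` of `per_n` of size `m` can be replaced by one, `B`, of the same size, whose class MODULO DEGREE-`q`
UNIMODULAR GAUGE is fixed by an admissibly cut subtorus `T_Λ` with `r ≤ n/2` generators (degree-`q` lifts of the
generators).  `q = 0` is implied by `OrbitDimensionBound` (`orbitGaugeBound_of_orbitDimensionBound`); for `q ≥ 1` the
in-place obstruction of `Disproof.lean` §4 (twisted Grenet lifts no homothety with constants) is void.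
[cite: LandsbergRessayre2017, Question 2.2] -/
def OrbitGaugeBound (q : ℕ) : Prop :=
  ∀ n : ℕ, 3 ≤ n → ∀ (m : ℕ) (A : Matrix (Fin m) (Fin m) (MvPolynomial (Fin n × Fin n) ℂ)),
    IsAffineDetRepr (perPoly (Fin n) ℂ) A →
    ∃ (B : Matrix (Fin m) (Fin m) (MvPolynomial (Fin n × Fin n) ℂ)) (r : ℕ) (Λ : Fin r → (Fin n ⊕ Fin n) → ℤ),
      r ≤ n / 2 ∧
      (∀ i, (∑ k, Λ i (Sum.inl k)) = 0 ∧ (∑ l, Λ i (Sum.inr l)) = 0) ∧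
      IsAffineDetRepr (perPoly (Fin n) ℂ) B ∧
      GaugeLifts q (subtorusGen n r Λ) B

/-- The host crux implies the relaxed target at every gauge degree. [cite: LandsbergRessayre2017, Question 2.2] -/
theorem orbitGaugeBound_of_orbitDimensionBound (q : ℕ)
    (h : Summit.ValiantsHypothesis.ValiantsHypothesis.Theses.FreeSubtorus.OrbitDimensionBound) : OrbitGaugeBound q := by
  intro n hn m A hA
  obtain ⟨B, r, Λ, hr, hΛ, hB⟩ := h n hn m A hA
  refine ⟨B, r, Λ, hr, hΛ, hB.1, GaugeLifts.mono (Nat.zero_le q) ?_⟩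
  exact (gaugeLifts_zero_iff _ _).mpr fun γ hγ => hB.2 γ (Subgroup.subset_closure hγ)

/-- **The relaxed closing: `OrbitGaugeBound q → GaugeCovering q → ValiantsHypothesis`.**  An optimal expression `A` of
`per_n` exists (`hasDetRepr_determinantalComplexity_holds`); re-realise it at size `dc(per_n)` with degree-`q` gauge
symmetry under an admissible `T_Λ`, `r ≤ n/2`; the rung gives `C(n,⌊n/2⌋) ≤ dc(per_n) · 2^r ≤ dc(per_n) · 2^{⌊n/2⌋}`;
gen 1's `vh_of_middle_bound` (the host route's arithmetic + `expDcGlue_proof`) concludes.  The host route's `closes` with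
BOTH cruxes moved one notch: #2 strengthened to the rung, #1 relaxed to gauge symmetry. [cite: LandsbergRessayre2017, Thm. 2.8, Question 2.2] -/
theorem closes_gauge {q : ℕ} (h₁ : OrbitGaugeBound q) (h₂ : GaugeCovering q) : _root_.ValiantsHypothesis := by
  refine vh_of_middle_bound fun n hn => ?_
  obtain ⟨A, hA⟩ := hasDetRepr_determinantalComplexity_holds (perPoly (Fin n) ℂ)
  obtain ⟨B, r, Λ, hr, hΛ, hB, hL⟩ := h₁ n hn _ A hA
  calc Nat.choose n (n / 2) ≤ determinantalComplexity (perPoly (Fin n) ℂ) * 2 ^ r := h₂ n hn _ r Λ B hΛ hB hL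
    _ ≤ determinantalComplexity (perPoly (Fin n) ℂ) * 2 ^ (n / 2) :=
        Nat.mul_le_mul_left _ (Nat.pow_le_pow_right (by norm_num) hr)

/-- The relaxed closing at the rung's own degree `q = 1`. [cite: LandsbergRessayre2017, Question 2.2] -/
theorem closes_affineGauge (h₁ : OrbitGaugeBound 1) (h₂ : AffineGaugeCovering) : _root_.ValiantsHypothesis :=
  closes_gauge h₁ h₂

/-- For comparison: the host route's own closing from the floor, by name. [cite: LandsbergRessayre2017, Thm. 2.8] -/
theorem closes_floor (h₁ : Summit.ValiantsHypothesis.ValiantsHypothesis.Theses.FreeSubtorus.OrbitDimensionBound) :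
    _root_.ValiantsHypothesis :=
  Summit.ValiantsHypothesis.ValiantsHypothesis.Theses.FreeSubtorus.closes h₁ (subtorusCovering_of_gaugeCovering gaugeCovering_zero)

end

end Summit.ValiantsHypothesis.ValiantsHypothesis.Cruxes.OrbitDimensionBound.Gauge
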